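import Literature.NumberTheory.EllipticCurves.PastenValuationProduct
import Literature.NumberTheory.DiophantineGeometry.ValuationProductElliptic
import Literature.NumberTheory.DiophantineGeometry.PastenValuationProductsProofs
import Literature.NumberTheory.DiophantineGeometry.ConductorRadicalProofs
import Literature.NumberTheory.EllipticCurves.BSDWave0
import Literature.NumberTheory.EllipticCurves.ModularCurveGenusBoundProofs
import Mathlib.NumberTheory.FLT.Four
import HarnessLib

/-!
# Mestre–Oesterlé for prime conductor (`v_p(Δ_E) ≤ 5`) — the glue to Theorem 1

Topic `NumberTheory/EllipticCurves`; namespace `Literature.NumberTheory.EllipticCurves` (and two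
dot-notation lemmas in `WeierstrassCurve`). Companion ("Proofs" sibling) of
`Literature.NumberTheory.EllipticCurves.PastenValuationProduct`, for its named fact
`mestreOesterle_factorization_le_five`: "If `N_E = p` is prime then `v_p(Δ_E) ≤ 5`
(cf. [MestreOesterle])" — the sentence opening the proof of Theorem 16.5 of H. Pasten, *Shimura
curves and the abc conjecture*, J. Number Theory 254 (2024) (arXiv:1705.09251, p. 50). Theorems
only: NO definition and NO new named fact (D-0026).

## Source

J.-F. Mestre, J. Oesterlé, *Courbes de Weil semi-stables de discriminant une puissance m-ième*,
J. reine angew. Math. 400 (1989) 173–184, read in full (2026-08-15) in the open digitisation of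
the volume by the Göttinger Digitalisierungszentrum (GDZ, PPN243919689_0400, article LOG_0012,
pp. 173–184; scan held as `paper:url-4ed15941427a`, image-only, OCR in GDZ's
`fulltext/PPN243919689_0400/00000179.xml`–`00000190.xml`; the publisher's copy
doi:10.1515/crll.1989.400.173 is paywalled). Theorem 1 as
printed (§4, p. 176): «Soient `E` une courbe elliptique semi-stable définie sur `ℚ`, `Δ` son
discriminant minimal et `m` un entier `≥ 1`. Supposons que `E` soit une courbe de Weil et que
`|Δ|` soit une puissance `m`-ième. On a alors `m ≤ 5` et `E` possède un point d'ordre `m`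
rationnel sur `ℚ`.» ("Courbe de Weil" = modular, §2 p. 174; every `E/ℚ` is modular by Wiles,
Taylor–Wiles, Breuil–Conrad–Diamond–Taylor, which is how [PastenShimura2024] uses the theorem;
the Remarque on p. 181 adds that Theorem 1 holds without the Weil hypothesis as soon as `m` has no
prime divisor `≥ 19`.) So the tree's `mestreOesterle1989_thm_1` (semistable `W/ℚ`,
`|Δ_min| = k^m`, `k ≥ 2` ⟹ `m ≤ 5`) is the first conclusion of Theorem 1, verbatim up to
modularity. Before the primary source was available the statements were taken from the zbMATH
review Zbl 0693.14004 (E.-U. Gekeler): "The main result is theorem 1: If `E` is [a semi-stable Weil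
curve over `ℚ`] such that `|Δ|` is an `m`-th power, then `m ≤ 5`, and `E` has an `m`-division point
over `ℚ`. As a consequence, the authors also show theorem 2: If the conductor of `E` is a prime `p`,
then (with few exceptions explicitly described) the minimal discriminant `Δ` equals `±p`. In the
proof of theorem 1, prime divisors `ℓ ≥ 11` of `m` are excluded by combining K. A. Ribet's result
[Invent. Math. 100, 431–476 (1990)] with an argument of J.-P. Serre [Duke Math. J. 54, 179–230
(1987)]. In difficult case by case considerations, it is then shown that `m` cannot be divisible by
`7, 10, 15, 6, 9, 25, 8`, which gives the bound `m ≤ 5`." ("Weil curve" = modular; every `E/ℚ` is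
modular by Wiles, Taylor–Wiles, Breuil–Conrad–Diamond–Taylor.)

## The tree's three renderings and what is proved here

The tree vendors this material three times, as unproved named facts:

* `Literature.NumberTheory.EllipticCurves.mestreOesterle1989_thm_1` — Theorem 1 itself
  (semistable `W/ℚ`, `|Δ_min| = k^m` with `k ≥ 2` ⟹ `m ≤ 5`);
* `Literature.NumberTheory.EllipticCurves.mestreOesterle_factorization_le_five` — prime conductor
  `p` ⟹ `v_p(Δ_min) ≤ 5` (Pasten's sentence);
* `Literature.NumberTheory.DiophantineGeometry.mestreOesterle1989_thm_1` — prime conductor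
  ⟹ `Δ_min ∣ N_E^5` (Sadek's phrasing, arXiv:1704.02056 p. 3).

This file proves that the last two are equivalent and follow from the first, i.e. the deduction
implicit in Pasten's "cf.": if `N_E = p` is prime then (i) `N_E` is squarefree, so `E` is
semistable (`WeierstrassCurve.isSemistable_iff_squarefree_conductorNorm`, Silverman ATAEC IV.10.2,
proved in `Literature.NumberTheory.DiophantineGeometry.PastenValuationProductsProofs` from the
discharged conductor-exponent dictionary), and (ii) `p` is the only prime dividing `Δ_min`
(`N_E` and `Δ_min` have the same prime divisors — the discharged `radical_conductorNorm_eq_holds`,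
Silverman AEC VII.5.1(a), VIII.11), so `|Δ_min| = p^m` with `m = v_p(Δ_min)` is an `m`-th power of
`p ≥ 2`, and Theorem 1 gives `m ≤ 5`:

* `WeierstrassCurve.primeFactors_minimalDiscriminantNorm` — `(Δ_min).primeFactors = (N_E).primeFactors`;
* `WeierstrassCurve.minimalDiscriminantNorm_eq_pow_of_prime_conductorNorm` — `N_E = p` prime ⟹
  `|Δ_min| = p ^ v_p(Δ_min)`;
* `mestreOesterle1989_thm_1.factorization_le_five` — Theorem 1 ⟹ `mestreOesterle_factorization_le_five`;
* `mestreOesterle_factorization_le_five_iff_dvd_pow_five` — `mestreOesterle_factorization_le_five ↔`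
  `Literature.NumberTheory.DiophantineGeometry.mestreOesterle1989_thm_1`;
* `mestreOesterle1989_thm_1.dvd_pow_five` — Theorem 1 ⟹ the `DiophantineGeometry` rendering.

(The direction `DiophantineGeometry.mestreOesterle1989_thm_1 → mestreOesterle_factorization_le_five`
is also `Literature.NumberTheory.DiophantineGeometry.mestreOesterle_factorization_le_five_of_thm_1`.)

## The skeleton of the printed proof of Theorem 1 (proved reduction, no new fact)

The review describes the proof of Theorem 1 as: prime divisors `ℓ ≥ 11` of `m` are excluded
(Ribet's level-lowering plus Serre's argument: for semistable `E` with `|Δ|` an `ℓ`-th power,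
`ρ̄_{E,ℓ}` is irreducible by Mazur and has Serre invariants `(N, k, ε) = (1, 2, 1)`, and there is
no cusp form of weight `2` and level `1` — Serre, Duke Math. J. 54 (1987), §4.4, Prop. 7, whose
hypothesis is likewise "`|Δ|` soit une puissance `p`-ème"), and then "`m` cannot be divisible by
`7, 10, 15, 6, 9, 25, 8`, which gives the bound `m ≤ 5`". The purely arithmetic content of that
last sentence and the resulting reduction are proved here:

* `MestreOesterle.six_le_cases` — every `m ≥ 6` has a prime divisor `ℓ ≥ 11` or is divisible by
  one of `7, 6, 8, 9, 10, 15, 25`;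
* `MestreOesterle.pow_case_of_dvd` — if `|Δ_min| = k^m` with `k ≥ 2` and `d ∣ m`, `m ≠ 0`, then
  `|Δ_min| = k'^d` with `k' = k^{m/d} ≥ 2` (an `m`-th power is a `d`-th power);
* `mestreOesterle1989_thm_1_of_cases` — Theorem 1 (`mestreOesterle1989_thm_1`) follows from the
  eight printed exclusions: no semistable elliptic `W/ℚ` has `|Δ_min|` an `ℓ`-th power for a prime
  `ℓ ≥ 11`, nor a `d`-th power for `d ∈ {6, 7, 8, 9, 10, 15, 25}` (of an integer `≥ 2`);
* `mestreOesterle1989_thm_1_iff_cases` — and conversely, so Theorem 1 is equivalent to these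
  eight exclusions.

The exclusions themselves (modularity of `E/ℚ` + Ribet + Mazur + the Tate-curve description of
`E[ℓ]` for `ℓ ≥ 11`; Kubert-family Diophantine analysis for the seven small cases) are not in the
tree; see "Status".

## The printed proof of Theorem 1 (pp. 173–181) and its status in the tree

"Indiquons le plan de la démonstration" (p. 177): if `E` is a Weil curve, `Δ` is not an `ℓ`-th
power for a prime `ℓ ≥ 11` by the Corollary of Prop. 2; parts 2), 4), 5), 6), 9) prove — WITHOUT
the Weil hypothesis — that `|Δ|` is not an `m`-th power for `m = 7, 10, 15, 6, 9, 25, 8`; "Cela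
implique l'inégalité `m ≤ 5`". These are exactly the eight exclusions of
`mestreOesterle1989_thm_1_iff_cases`. Ingredient by ingredient:

* §1, Prop. 1 (p. 173): for semistable `E` and a prime `ℓ`, `ρ_ℓ` (on `E[ℓ]`) is reducible iff
  its semisimplification is `1 ⊕ χ_ℓ` iff `E`, or `E/A` for a rational subgroup `A` of order `ℓ`,
  has a rational point of order `ℓ` (Serre 1972, p. 307). Corollary (p. 174): `ρ_ℓ` is irreducible
  for `ℓ ≥ 11` (`ℓ ≥ 7` if `E` has a rational point of order `2`, `ℓ ≥ 5` if all three), because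
  such an `E'` would carry a finite rational subgroup of order `ℓ`, `2ℓ` or `4ℓ`, against Mazur's
  Thm. 8. NOT in the tree: Prop. 1 (Tate curve at the multiplicative primes, structure of `E[ℓ]` at
  `ℓ`). PROVED here: the Mazur step, from the tree's named fact `mazur_torsion`
  (`MestreOesterle.card_le_of_mazur_torsion`, `MestreOesterle.corollary_prop_1_mazur_step`,
  `MestreOesterle.addOrderOf_lt_eleven_of_mazur_torsion`).
* §2, Prop. 2 (p. 175): `E` a semistable Weil curve, `ℓ` odd, `ρ_ℓ` irreducible, `M` the product
  of the primes whose exponent in `Δ` is not a multiple of `ℓ`, `ℓ ∤ M` ⟹ `ρ_ℓ` arises from a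
  nonzero weight-`2` cusp form on `Γ₀(M)` (Ribet's theorem [17]; finiteness of `ρ_ℓ` at the primes
  `p` with `ℓ ∣ v_p(Δ)`: Mazur 1972, p. 250). Corollary: no semistable Weil curve has
  `Δ = ±2^a 3^b n^ℓ`, `±2^a 5^b n^ℓ`, `±7^a n^ℓ` (`ℓ ≥ 11`), `±13^a n^ℓ` (`ℓ ≠ 13`), as
  `S₂(Γ₀(M)) = 0` for `M ∣ 6, 10, 7, 13`. NOT in the tree: Ribet's level-lowering and Tate's
  ramification/finiteness criterion (cf. the module docstring of `RibetTakahashiDefinite`);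
  modularity is the unproved `ModularForms.exists_isNewformOf` (or `khare_wintenberger`). PROVED
  here: the last step, `S₂(Γ₀(M)) = 0` for every `M` dividing `6`, `10`, `7` or `13`
  (`MestreOesterle.cuspForm_two_eq_zero_of_dvd`, from the tree's genus-zero dimension results
  `ModularForms.cuspForm_two_gamma0_eq_zero_of_le_ten`, `…_genusX0_thirteen`).
* Part 1) (`m = 3, 5`; the engine of parts 2), 4), 5), 6)): `Δ` an `ℓ`-th power ⟹ `E[ℓ]` is a
  finite flat group scheme over `ℤ` (Mazur 1972, Prop. 9.1) ⟹ `E[ℓ] ≅ ℤ/ℓ ⊕ μ_ℓ` (Fontaine 1985,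
  Thm. B, odd `ℓ ≤ 17`). NOT in the tree (no finite flat group schemes).
* Part 2) (`m = 7`): two distinct rational `7`-isogenies give a cyclic rational `49`-isogeny,
  but `Y₀(49)(ℚ) = ∅` (Ligozat). Part 6) (`m = 9, 25`): likewise a cyclic `27`-isogeny (the only
  point of `Y₀(27)(ℚ)` is CM, not semistable) resp. `125`-isogeny (Kenku). Part 4)
  (`m = 10, 15`): `E[5] ≅ ℤ/5 ⊕ μ_5` plus a rational `2`- or `3`-point contradicts Kubert 1976,
  Prop. III.2.5. NOT in the tree: it has only the `∃`-form `mazurKenku_exists_cyclic_isogeny` of the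
  Mazur–Kenku classification (not "every cyclic `ℚ`-isogeny has degree in Kenku's list").
* Part 3) (`m = 2`: `|Δ|` a square ⟹ a rational point of order `2`; Oort–Tate group schemes of
  order `2` over `ℤ`) and part 5) (`m = 6`: Lemma 2, `Y₀(36)(ℚ(i)) = ∅`). NOT in the tree.
* Lemma 1 (p. 175: a semistable `E` with a rational `2`-point has a unique model
  `y² = x(x² + ax + b)`, `gcd(a,b) = 1`, `P = (0,0)`, and `Δ_min = 2⁻⁸ b²(a² - 4b)`) and parts
  7), 8) (`±Δ` a fourth power ⟹ `E[4] ≅ ℤ/4 ⊕ μ_4`, via explicit `4`-division points on that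
  model). NOT in the tree (Tate's algorithm at `2`); only the identity `Δ = 16 b²(a² - 4b)` of
  that model is recorded (`MestreOesterle.Δ_twoTorsionModel`).
* Part 9) (`m = 8`, pp. 180–181): by 7), 8) there are coprime `a`, `b` with `b > 0` and
  `Δ = 2⁻⁸ b²(a² - 4b)`; then `b = u⁴`, `a² - 4b = ε v⁴`, and
  `(x, y) = (ε v²/(a - 2u²), 2uv/(a - 2u²))` is a rational point of `y² = x³ - εx`, i.e. of the
  curve `32A` (`ε = 1`) or `64A` (`ε = -1`) of the Antwerp tables, whose rational points all have
  order `2`; so `y = 0`, `uv = 0`, `Δ = 0`, absurd. PROVED here in full, the two table look-ups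
  included (`MestreOesterle.sq_mul_abs_ne_pow_eight`; `MestreOesterle.eq_zero_of_sq_eq_cube_sub_self`
  for `32A` by Fermat's descent on `pq(p² - q²) = □`, `MestreOesterle.mul_mul_sq_sub_sq_ne_sq`;
  `MestreOesterle.eq_zero_of_sq_eq_cube_add_self` for `64A` by Mathlib's `not_fermat_42`).

## Status

Deliberately NOT here: a proof of Theorem 1 (modularity of `E/ℚ`, the Tate-curve description of
`E[ℓ]` at multiplicative primes, Ribet's level-lowering to weight `2` and level `1`, Serre's
argument and Mazur's theorems in the reducible case, and the printed case analysis — none of it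
in Mathlib or `Literature/`). Hence `mestreOesterle_factorization_le_five_holds` is not yet
derivable; it is the one-liner `mestreOesterle1989_thm_1_holds.factorization_le_five` once
Theorem 1 is discharged. No elementary proof of the prime-conductor bound is known in print.

## References

* [MestreOesterle1989] J.-F. Mestre, J. Oesterlé, *Courbes de Weil semi-stables de discriminant
  une puissance m-ième*, J. reine angew. Math. 400 (1989) 173–184, doi:10.1515/crll.1989.400.173
  (open digitisation: GDZ Göttingen, PPN243919689_0400, LOG_0012) — §1 Prop. 1 and Corollaire
  (pp. 173–174), §2 Prop. 2 and Corollaire (p. 175), §3 Lemme 1 (p. 175), §4 Thm. 1 (p. 176),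
  Prop. 3 and the plan of proof (p. 177), parts 1)–9) (pp. 177–181), Remarque (p. 181), §5 Thm. 2
  (p. 183); Zbl 0693.14004.
* [Mazur1977] B. Mazur, *Modular curves and the Eisenstein ideal*, Publ. Math. IHÉS 47 (1977),
  Thm. 8 (the fifteen torsion groups; the tree's `mazur_torsion`).
* [Serre1987] J.-P. Serre, *Sur les représentations modulaires de degré 2 de Gal(Q̄/Q)*, Duke
  Math. J. 54 (1987) 179–230 — §4.4, Prop. 7 (semistable `E`, `|Δ|` a `p`-th power ⟹ rational
  subgroup of order `p` and `p ≤ 7`, assuming Serre's conjecture), Prop. 8 (prime conductor).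
* [PastenShimura2024] H. Pasten, *Shimura curves and the abc conjecture*, J. Number Theory 254
  (2024) 214–335, arXiv:1705.09251 — proof of Thm 16.5, first sentence (p. 50).
* [SilvermanAEC2009] J. H. Silverman, *The Arithmetic of Elliptic Curves*, 2nd ed., GTM 106 —
  VII.5.1(a), VIII.11 (bad primes = primes of `Δ_min` = primes of `N_E`).
* [Silverman1994] J. H. Silverman, *Advanced Topics in the Arithmetic of Elliptic Curves*, GTM 151 —
  IV.10.2 (`f_v ≤ 1` iff semistable at `v`).
-/

noncomputable section

open IsDedekindDomain UniqueFactorizationMonoid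

namespace WeierstrassCurve

variable (W : WeierstrassCurve ℚ) [W.IsElliptic]

/-- **`|Δ_min|` and `N_E` have the same prime factors** (the primes of bad reduction): for an
elliptic curve `W/ℚ`, `(W.minimalDiscriminantNorm ℤ).primeFactors = (W.conductorNorm ℤ).primeFactors`.
This is the discharged fact `radical_conductorNorm_eq_holds` (equal radicals in `ℕ`; Silverman AEC
VII.5.1(a), VIII.11) read through `Nat.primeFactors_radical`. (Dot-notation extension of the
Mathlib namespace `WeierstrassCurve`.) [cite: SilvermanAEC2009, VII.5.1(a) and VIII.11] -/
theorem primeFactors_minimalDiscriminantNorm :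
    (W.minimalDiscriminantNorm ℤ).primeFactors = (W.conductorNorm ℤ).primeFactors := by
  have hrad : radical (W.conductorNorm ℤ) = radical (W.minimalDiscriminantNorm ℤ) :=
    radical_conductorNorm_eq_holds W
  rw [← Nat.primeFactors_radical, ← hrad, Nat.primeFactors_radical]

/-- **Prime conductor: `|Δ_min| = p ^ {v_p(Δ_min)}`.** If the conductor `N_E = p` of an elliptic
curve `W/ℚ` is prime, then `p` is the only prime dividing the minimal discriminant
(`primeFactors_minimalDiscriminantNorm`), so `|Δ_min| = p ^ {v_p(Δ_min)}`
(`Nat.eq_pow_of_factorization_eq_single`); in particular `|Δ_min|` is a `v_p(Δ_min)`-th power, the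
form in which Mestre–Oesterlé's Theorem 1 applies to curves of prime conductor (Pasten, proof of
Thm 16.5). Silverman AEC VIII.11. (Dot-notation extension of the Mathlib namespace
`WeierstrassCurve`.) [cite: SilvermanAEC2009, VIII.11] -/
theorem minimalDiscriminantNorm_eq_pow_of_prime_conductorNorm (hp : (W.conductorNorm ℤ).Prime) :
    W.minimalDiscriminantNorm ℤ =
      W.conductorNorm ℤ ^ (W.minimalDiscriminantNorm ℤ).factorization (W.conductorNorm ℤ) := by
  have hD : (W.minimalDiscriminantNorm ℤ).primeFactors = {W.conductorNorm ℤ} := by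
    rw [primeFactors_minimalDiscriminantNorm, hp.primeFactors]
  have hD0 : W.minimalDiscriminantNorm ℤ ≠ 0 := by
    intro h0
    rw [h0, Nat.primeFactors_zero] at hD
    exact Finset.singleton_ne_empty _ hD.symm
  refine Nat.eq_pow_of_factorization_eq_single hD0 (Finsupp.support_subset_singleton.mp ?_)
  rw [Nat.support_factorization, hD]

end WeierstrassCurve

namespace Literature.NumberTheory.EllipticCurves

/-- **Mestre–Oesterlé, Thm 1 ⟹ `v_p(Δ_E) ≤ 5` for prime conductor** — the deduction behind the
opening sentence of the proof of [PastenShimura2024, Thm 16.5], "If `N_E = p` is prime then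
`v_p(Δ_E) ≤ 5` (cf. [MestreOesterle])": a prime conductor is squarefree, so `E` is semistable
(`WeierstrassCurve.isSemistable_iff_squarefree_conductorNorm`, Silverman ATAEC IV.10.2), and
`|Δ_E| = p^m` with `m = v_p(Δ_E)` (`WeierstrassCurve.minimalDiscriminantNorm_eq_pow_of_prime_conductorNorm`)
is an `m`-th power of `p ≥ 2`; Theorem 1 (semistable, `|Δ|` an `m`-th power ⟹ `m ≤ 5`,
Zbl 0693.14004) gives `m ≤ 5`. Hence the named fact `mestreOesterle_factorization_le_five` is
discharged by any discharge `h` of `mestreOesterle1989_thm_1`, as `h.factorization_le_five`.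
[cite: MestreOesterle1989, Thm. 1 (via Zbl 0693.14004)] -/
theorem mestreOesterle1989_thm_1.factorization_le_five (h : mestreOesterle1989_thm_1) :
    mestreOesterle_factorization_le_five := by
  intro W _ hp
  exact h W ((W.isSemistable_iff_squarefree_conductorNorm).mpr hp.prime.squarefree)
    ((W.minimalDiscriminantNorm ℤ).factorization (W.conductorNorm ℤ)) (W.conductorNorm ℤ) hp.two_le
    (W.minimalDiscriminantNorm_eq_pow_of_prime_conductorNorm hp)

/-- **The two prime-conductor vendorings of Mestre–Oesterlé coincide**:
`mestreOesterle_factorization_le_five` (`N_E = p` prime ⟹ `v_p(Δ_min) ≤ 5`, this directory) `↔`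
`Literature.NumberTheory.DiophantineGeometry.mestreOesterle1989_thm_1` (`N_E = p` prime ⟹
`Δ_min ∣ p^5`, the rendering of Sadek's "the minimal discriminant divides the fifth power of the
conductor"), because `|Δ_min| = p^{v_p(Δ_min)}` for prime conductor
(`WeierstrassCurve.minimalDiscriminantNorm_eq_pow_of_prime_conductorNorm`).
[cite: MestreOesterle1989, Thm. 1 (via Zbl 0693.14004)] -/
theorem mestreOesterle_factorization_le_five_iff_dvd_pow_five :
    mestreOesterle_factorization_le_five ↔
      Literature.NumberTheory.DiophantineGeometry.mestreOesterle1989_thm_1 := by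
  constructor
  · intro h W _ hp
    rw [W.minimalDiscriminantNorm_eq_pow_of_prime_conductorNorm hp]
    exact pow_dvd_pow _ (h W hp)
  · intro h W _ hp
    refine Literature.NumberTheory.DiophantineGeometry.mestreOesterle1989_thm_1.factorization_le
      h W hp ?_
    rw [W.minimalDiscriminantNorm_eq_pow_of_prime_conductorNorm hp]
    exact pow_ne_zero _ hp.ne_zero

/-- Consequently the `DiophantineGeometry` rendering `Δ_min ∣ N_E^5` (prime conductor) also follows
from Mestre–Oesterlé's Theorem 1 as vendored in this directory: for a discharge `h` of
`mestreOesterle1989_thm_1`, `h.dvd_pow_five`. [cite: MestreOesterle1989, Thm. 1 (via Zbl 0693.14004)] -/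
theorem mestreOesterle1989_thm_1.dvd_pow_five (h : mestreOesterle1989_thm_1) :
    Literature.NumberTheory.DiophantineGeometry.mestreOesterle1989_thm_1 :=
  mestreOesterle_factorization_le_five_iff_dvd_pow_five.mp h.factorization_le_five


/-! ## The skeleton of the printed proof of Theorem 1 -/

/-- **The case list of the printed proof** (Zbl 0693.14004: "prime divisors `ℓ ≥ 11` of `m` are
excluded … it is then shown that `m` cannot be divisible by `7, 10, 15, 6, 9, 25, 8`, which gives
the bound `m ≤ 5`"): an integer `m ≥ 6` either has a prime divisor `ℓ ≥ 11`, or is divisible by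
`7`, or — its prime divisors then lying in `{2, 3, 5}` — by one of `6, 10, 15` (two distinct
primes) or `8, 9, 25` (a prime power `≥ 6`). Elementary arithmetic.
[cite: MestreOesterle1989, proof of Thm. 1 (via Zbl 0693.14004)] -/
theorem MestreOesterle.six_le_cases {m : ℕ} (hm : 6 ≤ m) :
    (∃ ℓ : ℕ, ℓ.Prime ∧ 11 ≤ ℓ ∧ ℓ ∣ m) ∨
      7 ∣ m ∨ 6 ∣ m ∨ 8 ∣ m ∨ 9 ∣ m ∨ 10 ∣ m ∨ 15 ∣ m ∨ 25 ∣ m := by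
  by_cases H : ∃ ℓ : ℕ, ℓ.Prime ∧ 11 ≤ ℓ ∧ ℓ ∣ m
  · exact Or.inl H
  push Not at H
  -- every prime divisor of `m` is `< 11`
  have hlt : ∀ p : ℕ, p.Prime → p ∣ m → p < 11 := fun p hp hpm =>
    Nat.not_le.mp fun h11 => H p hp h11 hpm
  right
  by_cases h2 : 2 ∣ m
  · obtain ⟨n, rfl⟩ := h2
    rcases Nat.four_dvd_or_exists_odd_prime_and_dvd_of_two_lt (by omega : 2 < n) with h4 | ⟨p, hp, hpn, hodd⟩
    · -- `8 ∣ 2 n`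
      exact Or.inr <| Or.inr <| Or.inl (by obtain ⟨c, rfl⟩ := h4; exact ⟨c, by ring⟩)
    · have hp11 := hlt p hp (Dvd.dvd.mul_left hpn 2)
      have hp2 := hp.two_le
      interval_cases p
      · obtain ⟨r, hr⟩ := hodd; omega
      · -- p = 3: `6 ∣ 2 n`
        exact Or.inr <| Or.inl (by obtain ⟨c, rfl⟩ := hpn; exact ⟨c, by ring⟩)
      · exact absurd hp (by norm_num)
      · -- p = 5: `10 ∣ 2 n`
        exact Or.inr <| Or.inr <| Or.inr <| Or.inr <| Or.inl
          (by obtain ⟨c, rfl⟩ := hpn; exact ⟨c, by ring⟩)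
      · exact absurd hp (by norm_num)
      · -- p = 7
        exact Or.inl (Dvd.dvd.mul_left hpn 2)
      · exact absurd hp (by norm_num)
      · exact absurd hp (by norm_num)
      · exact absurd hp (by norm_num)
  by_cases h3 : 3 ∣ m
  · obtain ⟨n, rfl⟩ := h3
    have hn2 : 2 < n := by omega
    rcases Nat.four_dvd_or_exists_odd_prime_and_dvd_of_two_lt hn2 with h4 | ⟨p, hp, hpn, hodd⟩
    · exact absurd (Dvd.dvd.mul_left (dvd_trans (by norm_num : (2 : ℕ) ∣ 4) h4) 3) h2
    · have hp11 := hlt p hp (Dvd.dvd.mul_left hpn 3)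
      have hp2 := hp.two_le
      interval_cases p
      · obtain ⟨r, hr⟩ := hodd; omega
      · -- p = 3: `9 ∣ 3 n`
        exact Or.inr <| Or.inr <| Or.inr <| Or.inl (by obtain ⟨c, rfl⟩ := hpn; exact ⟨c, by ring⟩)
      · exact absurd hp (by norm_num)
      · -- p = 5: `15 ∣ 3 n`
        exact Or.inr <| Or.inr <| Or.inr <| Or.inr <| Or.inr <| Or.inl
          (by obtain ⟨c, rfl⟩ := hpn; exact ⟨c, by ring⟩)
      · exact absurd hp (by norm_num)
      · -- p = 7
        exact Or.inl (Dvd.dvd.mul_left hpn 3)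
      · exact absurd hp (by norm_num)
      · exact absurd hp (by norm_num)
      · exact absurd hp (by norm_num)
  by_cases h5 : 5 ∣ m
  · obtain ⟨n, rfl⟩ := h5
    have hn2 : 2 < n := by omega
    rcases Nat.four_dvd_or_exists_odd_prime_and_dvd_of_two_lt hn2 with h4 | ⟨p, hp, hpn, hodd⟩
    · exact absurd (Dvd.dvd.mul_left (dvd_trans (by norm_num : (2 : ℕ) ∣ 4) h4) 5) h2
    · have hp11 := hlt p hp (Dvd.dvd.mul_left hpn 5)
      have hp2 := hp.two_le
      interval_cases p
      · obtain ⟨r, hr⟩ := hodd; omega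
      · -- p = 3 contradicts `¬ 3 ∣ 5 n`
        exact absurd (Dvd.dvd.mul_left hpn 5) h3
      · exact absurd hp (by norm_num)
      · -- p = 5: `25 ∣ 5 n`
        exact Or.inr <| Or.inr <| Or.inr <| Or.inr <| Or.inr <| Or.inr
          (by obtain ⟨c, rfl⟩ := hpn; exact ⟨c, by ring⟩)
      · exact absurd hp (by norm_num)
      · -- p = 7
        exact Or.inl (Dvd.dvd.mul_left hpn 5)
      · exact absurd hp (by norm_num)
      · exact absurd hp (by norm_num)
      · exact absurd hp (by norm_num)
  -- no prime divisor `2, 3, 5`: the least prime divisor is `7`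
  have hm1 : m ≠ 1 := by omega
  have hq : (Nat.minFac m).Prime := Nat.minFac_prime hm1
  have hqm : Nat.minFac m ∣ m := Nat.minFac_dvd m
  have hq11 := hlt _ hq hqm
  have hq2 := hq.two_le
  set q := Nat.minFac m with hq_def
  interval_cases q
  · exact absurd hqm h2
  · exact absurd hqm h3
  · exact absurd hq (by norm_num)
  · exact absurd hqm h5
  · exact absurd hq (by norm_num)
  · exact Or.inl hqm
  · exact absurd hq (by norm_num)
  · exact absurd hq (by norm_num)
  · exact absurd hq (by norm_num)

/-- **An `m`-th power is a `d`-th power for `d ∣ m`**: if `|Δ_min(W)| = k^m` with `k ≥ 2`, `m ≠ 0`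
and `d ∣ m`, then `|Δ_min(W)| = (k^{m/d})^d` with `k^{m/d} ≥ 2`. (The step "let `ℓ` be a prime
divisor of `m`" of the printed proof.) [cite: MestreOesterle1989, proof of Thm. 1 (via Zbl 0693.14004)] -/
theorem MestreOesterle.pow_case_of_dvd {D m k d : ℕ} (hk : 2 ≤ k) (hD : D = k ^ m) (hm : m ≠ 0)
    (hd : d ∣ m) : 2 ≤ k ^ (m / d) ∧ D = (k ^ (m / d)) ^ d := by
  obtain ⟨e, rfl⟩ := hd
  have hd0 : d ≠ 0 := by rintro rfl; simp at hm
  have he0 : e ≠ 0 := by rintro rfl; simp at hm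
  rw [Nat.mul_div_cancel_left e (Nat.pos_of_ne_zero hd0)]
  refine ⟨?_, ?_⟩
  · calc 2 ≤ k := hk
      _ = k ^ 1 := (pow_one k).symm
      _ ≤ k ^ e := Nat.pow_le_pow_right (by omega) (Nat.one_le_iff_ne_zero.mpr he0)
  · rw [hD, ← pow_mul, mul_comm]

/-- **Mestre–Oesterlé's Theorem 1 from the eight cases of its printed proof.** If no semistable
elliptic `W/ℚ` has `|Δ_min|` equal to an `ℓ`-th power of an integer `≥ 2` for a prime `ℓ ≥ 11`
(in print: `E` modular ⟹ `ρ̄_{E,ℓ}` modular; `ℓ ∣ v_p(Δ_min)` for all `p` ⟹ `ρ̄_{E,ℓ}` finite at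
every `p`, so of Serre level `1` and weight `2` after Ribet's level-lowering; irreducible by Mazur
since `E` is semistable and `ℓ ≥ 11`; but `S₂(SL₂(ℤ)) = 0` — Serre, Duke 1987, §4.4, Prop. 7 made
unconditional for Weil curves by Ribet), and none has `|Δ_min|` a `d`-th power for
`d ∈ {6, 7, 8, 9, 10, 15, 25}` (the printed case-by-case analysis), then every semistable elliptic
`W/ℚ` with `|Δ_min| = k^m`, `k ≥ 2`, has `m ≤ 5`: otherwise `m ≥ 6` falls under
`MestreOesterle.six_le_cases`, and `|Δ_min|` is also a `d`-th power for each divisor `d` of `m`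
(`MestreOesterle.pow_case_of_dvd`). This is exactly the architecture of the proof of
[MestreOesterle1989, Thm. 1] as summarised in Zbl 0693.14004; the two hypotheses are the parts of
that proof not yet available in the tree (they are hypotheses of this reduction, not named facts).
[cite: MestreOesterle1989, Thm. 1 and its proof (via Zbl 0693.14004); Serre1987, §4.4 Prop. 7] -/
theorem mestreOesterle1989_thm_1_of_cases
    (hprime : ∀ ℓ : ℕ, ℓ.Prime → 11 ≤ ℓ → ∀ (W : WeierstrassCurve ℚ) [W.IsElliptic],
      W.IsSemistable ℤ → ∀ k : ℕ, 2 ≤ k → W.minimalDiscriminantNorm ℤ ≠ k ^ ℓ)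
    (hsmall : ∀ d ∈ ({6, 7, 8, 9, 10, 15, 25} : Finset ℕ), ∀ (W : WeierstrassCurve ℚ) [W.IsElliptic],
      W.IsSemistable ℤ → ∀ k : ℕ, 2 ≤ k → W.minimalDiscriminantNorm ℤ ≠ k ^ d) :
    mestreOesterle1989_thm_1 := by
  intro W _ hW m k hk hΔ
  by_contra hm
  have hm6 : 6 ≤ m := by omega
  have hm0 : m ≠ 0 := by omega
  -- `|Δ_min|` is a `d`-th power of an integer `≥ 2` for every `d ∣ m`
  have hcase : ∀ d : ℕ, d ∣ m → ∃ k' : ℕ, 2 ≤ k' ∧ W.minimalDiscriminantNorm ℤ = k' ^ d :=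
    fun d hd => ⟨k ^ (m / d), MestreOesterle.pow_case_of_dvd hk hΔ hm0 hd⟩
  have hsmall' : ∀ d ∈ ({6, 7, 8, 9, 10, 15, 25} : Finset ℕ), ¬ d ∣ m := by
    intro d hd hdm
    obtain ⟨k', hk', hΔ'⟩ := hcase d hdm
    exact hsmall d hd W hW k' hk' hΔ'
  rcases MestreOesterle.six_le_cases hm6 with ⟨ℓ, hℓ, h11, hℓm⟩ | h | h | h | h | h | h | h
  · obtain ⟨k', hk', hΔ'⟩ := hcase ℓ hℓm
    exact hprime ℓ hℓ h11 W hW k' hk' hΔ'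
  · exact hsmall' 7 (by simp) h
  · exact hsmall' 6 (by simp) h
  · exact hsmall' 8 (by simp) h
  · exact hsmall' 9 (by simp) h
  · exact hsmall' 10 (by simp) h
  · exact hsmall' 15 (by simp) h
  · exact hsmall' 25 (by simp) h

/-- **Theorem 1 is equivalent to the eight exclusions of its printed proof**: conversely, Theorem 1
forbids `|Δ_min| = k^d` (`k ≥ 2`) for every `d ≥ 6`, in particular for the primes `ℓ ≥ 11` and for
`d ∈ {6, 7, 8, 9, 10, 15, 25}`. [cite: MestreOesterle1989, Thm. 1 and its proof (via Zbl 0693.14004)] -/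
theorem mestreOesterle1989_thm_1_iff_cases :
    mestreOesterle1989_thm_1 ↔
      (∀ ℓ : ℕ, ℓ.Prime → 11 ≤ ℓ → ∀ (W : WeierstrassCurve ℚ) [W.IsElliptic],
          W.IsSemistable ℤ → ∀ k : ℕ, 2 ≤ k → W.minimalDiscriminantNorm ℤ ≠ k ^ ℓ) ∧
        (∀ d ∈ ({6, 7, 8, 9, 10, 15, 25} : Finset ℕ), ∀ (W : WeierstrassCurve ℚ) [W.IsElliptic],
          W.IsSemistable ℤ → ∀ k : ℕ, 2 ≤ k → W.minimalDiscriminantNorm ℤ ≠ k ^ d) := by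
  refine ⟨fun h => ⟨?_, ?_⟩, fun h => mestreOesterle1989_thm_1_of_cases h.1 h.2⟩
  · intro ℓ _ h11 W _ hW k hk hΔ
    have := h W hW ℓ k hk hΔ
    omega
  · intro d hd W _ hW k hk hΔ
    have h5 := h W hW d k hk hΔ
    simp only [Finset.mem_insert, Finset.mem_singleton] at hd
    omega


/-! ## Proved pieces of the printed proof: part 9) (`m = 8`), the Mazur step of the Corollary of
Prop. 1, and the last step of the Corollary of Prop. 2

Everything below is proved (no named fact). The Diophantine engine of part 9) is Fermat's theorem
on right triangles — for coprime `0 < q < p`, `pq(p² - q²)` is not a square — proved by Fermat's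
descent (`MestreOesterle.mul_mul_sq_sub_sq_ne_sq_of_lt`), together with Mathlib's `not_fermat_42`
(`a⁴ + b⁴ ≠ c²`). -/

namespace MestreOesterle

/-! ### Fermat: `pq(p² - q²)` is not a square -/

/-- An odd integer is coprime to `2` (explicit Bézout witness). [folklore] -/
private theorem isCoprime_two_right_of_emod {x : ℤ} (hx : x % 2 = 1) : IsCoprime x 2 :=
  ⟨1, -(x / 2), by omega⟩

/-- Transport of coprimality along an equality of the right argument. [folklore] -/
private theorem isCoprime_of_eq_right {a b b' : ℤ} (h : IsCoprime a b) (e : b = b') :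
    IsCoprime a b' := e ▸ h

/-- Descent step, both `p` and `q` odd: pass to `((p+q)/2, (p-q)/2)`. [folklore] -/
private theorem fermat_step_odd {p q r : ℤ} (hq : 0 < q) (hqp : q < p) (hcop : IsCoprime p q)
    (h : p * q * (p ^ 2 - q ^ 2) = r ^ 2) (hp2 : p % 2 = 1) (hq2 : q % 2 = 1) :
    ∃ s t r' : ℤ, 0 < t ∧ t < s ∧ IsCoprime s t ∧ s * t * (s ^ 2 - t ^ 2) = r' ^ 2 ∧
      s * t * (s ^ 2 - t ^ 2) < p * q * (p ^ 2 - q ^ 2) := by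
  obtain ⟨s, hs⟩ : ∃ s, p + q = 2 * s := ⟨(p + q) / 2, by omega⟩
  obtain ⟨t, ht⟩ : ∃ t, p - q = 2 * t := ⟨(p - q) / 2, by omega⟩
  have hp : p = s + t := by omega
  have hq' : q = s - t := by omega
  have h4 : r ^ 2 = 2 * (2 * (s * t * (s ^ 2 - t ^ 2))) := by rw [← h, hp, hq']; ring
  obtain ⟨r', hr'⟩ : (2 : ℤ) ∣ r := Int.prime_two.dvd_of_dvd_pow (n := 2) ⟨_, h4⟩
  have hpos : 0 < p * q * (p ^ 2 - q ^ 2) := by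
    have h1 : 0 < p ^ 2 - q ^ 2 := by nlinarith
    have h2 : 0 < p := lt_trans hq hqp
    positivity
  have hpq4 : p * q * (p ^ 2 - q ^ 2) = 2 * (2 * (s * t * (s ^ 2 - t ^ 2))) := by rw [h, h4]
  refine ⟨s, t, r', by omega, by omega, ?_, ?_, by linarith⟩
  · obtain ⟨u, v, huv⟩ := hcop
    exact ⟨u + v, u - v, by rw [hp, hq'] at huv; linear_combination huv⟩
  · have : 2 * (2 * (s * t * (s ^ 2 - t ^ 2))) = 2 * (2 * r' ^ 2) := by rw [← h4, hr']; ring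
    linarith

/-- Descent step, `p` and `q` of opposite parity: `p`, `q`, `p - q`, `p + q` are pairwise coprime
positive integers with square product, hence squares `a², b², e², f²`; with `u = (f+e)/2`,
`v = (f-e)/2` one has `u² + v² = a²`, `uv = 2b'²` (`b = 2b'`), and the parametrisation of the
primitive Pythagorean triple `(u, v, a)` by `(m, n)` gives `mn(m² - n²) = b'²`. [folklore] -/
private theorem fermat_step_mixed {p q r : ℤ} (hq : 0 < q) (hqp : q < p) (hcop : IsCoprime p q)
    (h : p * q * (p ^ 2 - q ^ 2) = r ^ 2) (hodd : (p + q) % 2 = 1) :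
    ∃ s t r' : ℤ, 0 < t ∧ t < s ∧ IsCoprime s t ∧ s * t * (s ^ 2 - t ^ 2) = r' ^ 2 ∧
      s * t * (s ^ 2 - t ^ 2) < p * q * (p ^ 2 - q ^ 2) := by
  have hp : 0 < p := lt_trans hq hqp
  have hpmq : 0 < p - q := by omega
  have hppq : 0 < p + q := by omega
  -- pairwise coprimality of `p`, `q`, `p - q`, `p + q` (Bézout witnesses)
  obtain ⟨α, β, hαβ⟩ := hcop
  have c_pmq_q : IsCoprime (p - q) q := ⟨α, α + β, by linear_combination hαβ⟩
  have c_ppq_q : IsCoprime (p + q) q := ⟨α, β - α, by linear_combination hαβ⟩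
  have c_pmq_p : IsCoprime (p - q) p := ⟨-β, α + β, by linear_combination hαβ⟩
  have c_ppq_p : IsCoprime (p + q) p := ⟨β, α - β, by linear_combination hαβ⟩
  have hcop : IsCoprime p q := ⟨α, β, hαβ⟩
  have c_pmq_ppq : IsCoprime (p - q) (p + q) := by
    have h2 : IsCoprime (p - q) 2 := isCoprime_two_right_of_emod (by omega)
    exact isCoprime_of_eq_right ((h2.mul_right c_pmq_q).add_mul_left_right 1) (by ring)
  -- the four squares
  obtain ⟨a, ha⟩ : ∃ a, p = a ^ 2 := by
    have hc : IsCoprime p (q * ((p - q) * (p + q))) :=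
      hcop.mul_right (c_pmq_p.symm.mul_right c_ppq_p.symm)
    have h' : p * (q * ((p - q) * (p + q))) = r ^ 2 := by linear_combination h
    obtain ⟨a, ha | ha⟩ := Int.sq_of_isCoprime hc h'
    · exact ⟨a, ha⟩
    · nlinarith [sq_nonneg a]
  obtain ⟨b, hb⟩ : ∃ b, q = b ^ 2 := by
    have hc : IsCoprime q (p * ((p - q) * (p + q))) :=
      hcop.symm.mul_right (c_pmq_q.symm.mul_right c_ppq_q.symm)
    have h' : q * (p * ((p - q) * (p + q))) = r ^ 2 := by linear_combination h
    obtain ⟨b, hb | hb⟩ := Int.sq_of_isCoprime hc h'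
    · exact ⟨b, hb⟩
    · nlinarith [sq_nonneg b]
  obtain ⟨e, he, he0⟩ : ∃ e, p - q = e ^ 2 ∧ 0 ≤ e := by
    have hc : IsCoprime (p - q) (p * (q * (p + q))) :=
      c_pmq_p.mul_right (c_pmq_q.mul_right c_pmq_ppq)
    have h' : (p - q) * (p * (q * (p + q))) = r ^ 2 := by linear_combination h
    obtain ⟨e, he | he⟩ := Int.sq_of_isCoprime hc h'
    · exact ⟨|e|, by rw [sq_abs]; exact he, abs_nonneg e⟩
    · nlinarith [sq_nonneg e]
  obtain ⟨f, hf, hf0⟩ : ∃ f, p + q = f ^ 2 ∧ 0 ≤ f := by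
    have hc : IsCoprime (p + q) (p * (q * (p - q))) :=
      c_ppq_p.mul_right (c_ppq_q.mul_right c_pmq_ppq.symm)
    have h' : (p + q) * (p * (q * (p - q))) = r ^ 2 := by linear_combination h
    obtain ⟨f, hf | hf⟩ := Int.sq_of_isCoprime hc h'
    · exact ⟨|f|, by rw [sq_abs]; exact hf, abs_nonneg f⟩
    · nlinarith [sq_nonneg f]
  -- `0 < e < f`, both odd
  have he_pos : 0 < e := by
    rcases he0.lt_or_eq with h' | h'
    · exact h'
    · rw [← h'] at he; omega
  have hef : e < f := by
    rcases lt_or_ge e f with h' | hle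
    · exact h'
    · have : f ^ 2 ≤ e ^ 2 := pow_le_pow_left₀ hf0 hle 2
      omega
  have he2 : e % 2 = 1 := by
    rcases Int.emod_two_eq_zero_or_one e with h0 | h1
    · obtain ⟨k, hk⟩ : (2 : ℤ) ∣ e := Int.dvd_of_emod_eq_zero h0
      have : p - q = 2 * (2 * k ^ 2) := by rw [he, hk]; ring
      omega
    · exact h1
  have hf2 : f % 2 = 1 := by
    rcases Int.emod_two_eq_zero_or_one f with h0 | h1
    · obtain ⟨k, hk⟩ : (2 : ℤ) ∣ f := Int.dvd_of_emod_eq_zero h0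
      have : p + q = 2 * (2 * k ^ 2) := by rw [hf, hk]; ring
      omega
    · exact h1
  obtain ⟨u, hu⟩ : ∃ u, f + e = 2 * u := ⟨(f + e) / 2, by omega⟩
  obtain ⟨v, hv⟩ : ∃ v, f - e = 2 * v := ⟨(f - e) / 2, by omega⟩
  have hu_pos : 0 < u := by omega
  have hv_pos : 0 < v := by omega
  have hf' : f = u + v := by omega
  have he' : e = u - v := by omega
  -- `u² + v² = p = a²`, `2uv = q = b²`
  have huva : u ^ 2 + v ^ 2 = p := by
    have h1 : f ^ 2 + e ^ 2 = 2 * p := by rw [← hf, ← he]; ring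
    have h2 : f ^ 2 + e ^ 2 = 2 * (u ^ 2 + v ^ 2) := by rw [hf', he']; ring
    linarith
  have huvq : 2 * (u * v) = q := by
    have h1 : f ^ 2 - e ^ 2 = 2 * q := by rw [← hf, ← he]; ring
    have h2 : f ^ 2 - e ^ 2 = 2 * (2 * (u * v)) := by rw [hf', he']; ring
    linarith
  -- `b` is even, `uv = 2b'²`
  obtain ⟨b', hb'⟩ : (2 : ℤ) ∣ b :=
    Int.prime_two.dvd_of_dvd_pow (n := 2) ⟨u * v, by rw [← hb, huvq]⟩
  have huvb : u * v = 2 * b' ^ 2 := by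
    have : 2 * (u * v) = 2 * (2 * b' ^ 2) := by rw [huvq, hb, hb']; ring
    linarith
  -- `gcd(u, v) = 1`
  have cef : IsCoprime e f := by
    have : IsCoprime (e ^ 2) (f ^ 2) := by rw [← he, ← hf]; exact c_pmq_ppq
    exact (IsCoprime.pow_left_iff two_pos).mp ((IsCoprime.pow_right_iff two_pos).mp this)
  have cuv : IsCoprime u v := by
    obtain ⟨γ, δ, hγδ⟩ := cef
    refine ⟨γ + δ, δ - γ, ?_⟩
    rw [he', hf'] at hγδ
    linear_combination hγδ
  have hgcd : Int.gcd u v = 1 := Int.isCoprime_iff_gcd_eq_one.mp cuv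
  -- `|a| > 0`
  have ha0 : a ≠ 0 := by
    rintro rfl
    simp at ha
    omega
  have ha₀pos : 0 < |a| := abs_pos.mpr ha0
  have ha₀sq : u ^ 2 + v ^ 2 = |a| ^ 2 := by rw [sq_abs, ← ha]; exact huva
  -- parametrise the primitive Pythagorean triple: odd leg `m² - n²`, even leg `2mn`
  obtain ⟨m, n, ⟨o, ev, ho, hev, hoev, ho_pos, hev_pos⟩, -, hmn, hm0⟩ :
      ∃ m n : ℤ, (∃ o ev : ℤ, o = m ^ 2 - n ^ 2 ∧ ev = 2 * m * n ∧ o * ev = u * v ∧ 0 < o ∧ 0 < ev)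
        ∧ |a| = m ^ 2 + n ^ 2 ∧ Int.gcd m n = 1 ∧ 0 ≤ m := by
    rcases Int.emod_two_eq_zero_or_one u with hu2 | hu2
    · -- `u` even, so `v` odd
      have hv2 : v % 2 = 1 := by
        rcases Int.emod_two_eq_zero_or_one v with hv2 | hv2
        · exfalso
          have h2 : IsUnit (2 : ℤ) :=
            cuv.isUnit_of_dvd' (Int.dvd_of_emod_eq_zero hu2) (Int.dvd_of_emod_eq_zero hv2)
          rcases Int.isUnit_iff.mp h2 with h2 | h2 <;> norm_num at h2
        · exact hv2
      have ht : PythagoreanTriple v u |a| := by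
        delta PythagoreanTriple; linear_combination ha₀sq
      obtain ⟨m, n, h1, h2, h3, h4, -, h6⟩ :=
        ht.coprime_classification' (by rw [Int.gcd_comm]; exact hgcd) hv2 ha₀pos
      exact ⟨m, n, ⟨v, u, h1, h2, by ring, hv_pos, hu_pos⟩, h3, h4, h6⟩
    · have ht : PythagoreanTriple u v |a| := by
        delta PythagoreanTriple; linear_combination ha₀sq
      obtain ⟨m, n, h1, h2, h3, h4, -, h6⟩ := ht.coprime_classification' hgcd hu2 ha₀pos
      exact ⟨m, n, ⟨u, v, h1, h2, rfl, hu_pos, hv_pos⟩, h3, h4, h6⟩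
  -- the new solution `(m, n, b')`
  have hm_pos : 0 < m := by
    rcases hm0.lt_or_eq with h' | h'
    · exact h'
    · rw [← h'] at hev; omega
  have hn_pos : 0 < n := by
    rcases lt_or_ge 0 n with h' | hle
    · exact h'
    · have : ev ≤ 0 := by
        rw [hev]; exact mul_nonpos_of_nonneg_of_nonpos (by positivity) hle
      omega
  have hnm : n < m := by
    rcases lt_or_ge n m with h' | hle
    · exact h'
    · have : m ^ 2 ≤ n ^ 2 := pow_le_pow_left₀ hm0 hle 2
      have : o ≤ 0 := by rw [ho]; linarith
      omega
  have hnew : m * n * (m ^ 2 - n ^ 2) = b' ^ 2 := by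
    have : o * ev = 2 * (m * n * (m ^ 2 - n ^ 2)) := by rw [ho, hev]; ring
    linarith
  refine ⟨m, n, b', hn_pos, hnm, Int.isCoprime_iff_gcd_eq_one.mpr hmn, hnew, ?_⟩
  -- the measure decreases: `mn(m² - n²) = b'² = q/4 < pq(p² - q²)`
  have hq4 : q = 4 * b' ^ 2 := by rw [hb, hb']; ring
  have h1 : 3 ≤ p ^ 2 - q ^ 2 := by nlinarith
  have h2 : 2 ≤ p := by omega
  have e1 : p * q * (p ^ 2 - q ^ 2) = p * (q * (p ^ 2 - q ^ 2)) := by ring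
  have e2 : q * 3 ≤ q * (p ^ 2 - q ^ 2) := mul_le_mul_of_nonneg_left h1 hq.le
  have e3 : 2 * (q * (p ^ 2 - q ^ 2)) ≤ p * (q * (p ^ 2 - q ^ 2)) :=
    mul_le_mul_of_nonneg_right h2 (by positivity)
  rw [hnew]
  linarith

/-- **Fermat's theorem on right triangles** (the area of a Pythagorean triangle is not a square;
equivalently `1` is not a congruent number; Fermat's one complete proof by infinite descent): for
coprime integers `0 < q < p`, `pq(p² - q²)` is not a square. [folklore] -/
theorem mul_mul_sq_sub_sq_ne_sq_of_lt {p q : ℤ} (hq : 0 < q) (hqp : q < p) (hcop : IsCoprime p q)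
    (r : ℤ) : p * q * (p ^ 2 - q ^ 2) ≠ r ^ 2 := by
  suffices H : ∀ (n : ℕ) (p q r : ℤ), p * q * (p ^ 2 - q ^ 2) = n → 0 < q → q < p →
      IsCoprime p q → p * q * (p ^ 2 - q ^ 2) ≠ r ^ 2 by
    have hpos : 0 ≤ p * q * (p ^ 2 - q ^ 2) := by
      have h1 : 0 < p ^ 2 - q ^ 2 := by nlinarith
      have h2 : 0 < p := lt_trans hq hqp
      positivity
    exact H _ p q r (Int.toNat_of_nonneg hpos).symm hq hqp hcop
  intro n
  induction n using Nat.strong_induction_on with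
  | _ n ih =>
    intro p q r hn hq hqp hcop h
    have step : ∃ s t r' : ℤ, 0 < t ∧ t < s ∧ IsCoprime s t ∧
        s * t * (s ^ 2 - t ^ 2) = r' ^ 2 ∧ s * t * (s ^ 2 - t ^ 2) < p * q * (p ^ 2 - q ^ 2) := by
      rcases Int.emod_two_eq_zero_or_one p with hp2 | hp2 <;>
        rcases Int.emod_two_eq_zero_or_one q with hq2 | hq2
      · exfalso
        have h2 : IsUnit (2 : ℤ) :=
          hcop.isUnit_of_dvd' (Int.dvd_of_emod_eq_zero hp2) (Int.dvd_of_emod_eq_zero hq2)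
        rcases Int.isUnit_iff.mp h2 with h2 | h2 <;> norm_num at h2
      · exact fermat_step_mixed hq hqp hcop h (by omega)
      · exact fermat_step_mixed hq hqp hcop h (by omega)
      · exact fermat_step_odd hq hqp hcop h hp2 hq2
    obtain ⟨s, t, r', ht, hts, hst, hEq, hlt⟩ := step
    have hnonneg : 0 ≤ s * t * (s ^ 2 - t ^ 2) := by rw [hEq]; exact sq_nonneg r'
    exact ih (s * t * (s ^ 2 - t ^ 2)).toNat (by omega) s t r'
      (Int.toNat_of_nonneg hnonneg).symm ht hts hst hEq

/-- Sign-free form of Fermat's theorem: for coprime nonzero `p`, `q` with `p² ≠ q²`,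
`pq(p² - q²)` is not a square. [folklore] -/
theorem mul_mul_sq_sub_sq_ne_sq {p q : ℤ} (hcop : IsCoprime p q) (hp : p ≠ 0) (hq : q ≠ 0)
    (hne : p ^ 2 ≠ q ^ 2) (r : ℤ) : p * q * (p ^ 2 - q ^ 2) ≠ r ^ 2 := by
  intro h
  have hP : 0 < |p| := abs_pos.mpr hp
  have hQ : 0 < |q| := abs_pos.mpr hq
  have hcop' : IsCoprime |p| |q| := by
    rw [Int.isCoprime_iff_gcd_eq_one] at hcop ⊢
    rw [Int.gcd_eq_natAbs, Int.natAbs_abs, Int.natAbs_abs, ← Int.gcd_eq_natAbs]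
    exact hcop
  have habs : |p| * |q| * |p ^ 2 - q ^ 2| = r ^ 2 := by
    have := congrArg (fun z : ℤ => |z|) h
    simp only [abs_mul, abs_pow] at this
    rw [this, sq_abs]
  rcases lt_trichotomy |p| |q| with hlt | heq | hgt
  · refine mul_mul_sq_sub_sq_ne_sq_of_lt hP hlt hcop'.symm r ?_
    have hle : p ^ 2 - q ^ 2 ≤ 0 := by nlinarith [sq_abs p, sq_abs q]
    rw [abs_of_nonpos hle] at habs
    rw [sq_abs, sq_abs]
    linear_combination habs
  · exact hne (by rw [← sq_abs p, ← sq_abs q, heq])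
  · refine mul_mul_sq_sub_sq_ne_sq_of_lt hQ hgt hcop' r ?_
    have hle : 0 ≤ p ^ 2 - q ^ 2 := by nlinarith [sq_abs p, sq_abs q]
    rw [abs_of_nonneg hle] at habs
    rw [← habs, sq_abs, sq_abs]


/-! ### Rational points of `32A : y² = x³ - x` and `64A : y² = x³ + x` -/

/-- A rational number whose square is an integer is an integer. [folklore] -/
private theorem exists_int_eq_of_sq_eq_intCast {t : ℚ} {M : ℤ} (h : t ^ 2 = M) :
    ∃ z : ℤ, t = z := by
  have hden : (t ^ 2).den = 1 := by rw [h]; exact Rat.den_intCast M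
  rw [Rat.den_pow] at hden
  have ht : t.den = 1 := by
    rcases Nat.pow_eq_one.mp hden with h1 | h1
    · exact h1
    · exact absurd h1 two_ne_zero
  exact ⟨t.num, (Rat.coe_int_num_of_den_eq_one ht).symm⟩

/-- Clearing denominators: if `y² = x³ + c·x` over `ℚ` with `c : ℤ` and `x = p/q` in lowest
terms, then `p q (p² + c q²)` is the square of the integer `y q²`. [folklore] -/
private theorem exists_sq_eq_of_weierstrass {x y : ℚ} {c : ℤ} (h : y ^ 2 = x ^ 3 + c * x) :
    ∃ r : ℤ, x.num * x.den * (x.num ^ 2 + c * (x.den : ℤ) ^ 2) = r ^ 2 := by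
  have hxq : x * (x.den : ℚ) = x.num := Rat.mul_den_eq_num x
  have key : (y * (x.den : ℚ) ^ 2) ^ 2 =
      ((x.num * x.den * (x.num ^ 2 + c * (x.den : ℤ) ^ 2) : ℤ) : ℚ) := by
    push_cast
    rw [← hxq]
    linear_combination ((x.den : ℚ) ^ 4) * h
  obtain ⟨r, hr⟩ := exists_int_eq_of_sq_eq_intCast key
  refine ⟨r, ?_⟩
  have : ((x.num * x.den * (x.num ^ 2 + c * (x.den : ℤ) ^ 2) : ℤ) : ℚ) = ((r ^ 2 : ℤ) : ℚ) := by
    rw [← key, hr]; push_cast; ring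
  exact_mod_cast this

/-- `x.num` and `x.den` are coprime integers. [folklore] -/
private theorem isCoprime_num_den (x : ℚ) : IsCoprime x.num (x.den : ℤ) := by
  rw [Int.isCoprime_iff_gcd_eq_one, Int.gcd_eq_natAbs]
  simpa using x.reduced

/-- **The curve `32A` of the Antwerp tables (`y² = x³ - x`, conductor `32`) has only its three
points of order `2` and `O` as rational points**: every rational solution of `y² = x³ - x` has
`y = 0`. Classical (Fermat): with `x = p/q` in lowest terms, `pq(p² - q²) = (yq²)²`, which forces
`pq(p² - q²) = 0` by Fermat's theorem on right triangles (`mul_mul_sq_sub_sq_ne_sq`). This is the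
first of the two facts read off the tables [1] (= Antwerp IV) in part 9) of the proof of
[MestreOesterle1989, Thm. 1] ("les seuls points rationnels de ces courbes sont des points
d'ordre 2"). [cite: MestreOesterle1989, §4, proof of Thm. 1, part 9, p. 181] -/
theorem eq_zero_of_sq_eq_cube_sub_self {x y : ℚ} (h : y ^ 2 = x ^ 3 - x) : y = 0 := by
  obtain ⟨r, hr⟩ := exists_sq_eq_of_weierstrass (c := -1) (by rw [h]; push_cast; ring)
  have hcop := isCoprime_num_den x
  have hqQ : (x.den : ℚ) ≠ 0 := by exact_mod_cast x.den_pos.ne'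
  by_cases hp0 : x.num = 0
  · have hx0 : x = 0 := by rw [← Rat.num_div_den x, hp0]; simp
    rw [hx0] at h
    have : y ^ 2 = 0 := by rw [h]; ring
    exact pow_eq_zero_iff two_ne_zero |>.mp this
  by_cases hpq : x.num ^ 2 = (x.den : ℤ) ^ 2
  · have hx2 : x ^ 2 = 1 := by
      have hpq' : (x.num : ℚ) ^ 2 = (x.den : ℚ) ^ 2 := by exact_mod_cast hpq
      rw [← Rat.num_div_den x, div_pow, hpq', div_self (pow_ne_zero 2 hqQ)]
    have : y ^ 2 = 0 := by linear_combination h + x * hx2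
    exact pow_eq_zero_iff two_ne_zero |>.mp this
  · exfalso
    have hq0 : ((x.den : ℕ) : ℤ) ≠ 0 := by exact_mod_cast x.den_pos.ne'
    refine mul_mul_sq_sub_sq_ne_sq hcop hp0 hq0 hpq r ?_
    linear_combination hr

/-- **The curve `64A` of the Antwerp tables (`y² = x³ + x`, conductor `64`) has only `(0,0)` and
`O` as rational points**: every rational solution of `y² = x³ + x` has `y = 0`. Classical
(Fermat): with `x = p/q` in lowest terms and `p > 0`, the pairwise coprime `p`, `q`, `p² + q²` have
square product, so are squares `A², B², C²` with `A⁴ + B⁴ = C²`, contradicting Fermat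
(`not_fermat_42`, Mathlib). The second table fact used in part 9) of the proof of
[MestreOesterle1989, Thm. 1]. [cite: MestreOesterle1989, §4, proof of Thm. 1, part 9, p. 181] -/
theorem eq_zero_of_sq_eq_cube_add_self {x y : ℚ} (h : y ^ 2 = x ^ 3 + x) : y = 0 := by
  obtain ⟨r, hr⟩ := exists_sq_eq_of_weierstrass (c := 1) (by rw [h]; push_cast; ring)
  have hcop := isCoprime_num_den x
  by_cases hp0 : x.num = 0
  · have hx0 : x = 0 := by rw [← Rat.num_div_den x, hp0]; simp
    rw [hx0] at h
    have : y ^ 2 = 0 := by rw [h]; ring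
    exact pow_eq_zero_iff two_ne_zero |>.mp this
  exfalso
  have hq : (0 : ℤ) < x.den := by exact_mod_cast x.den_pos
  generalize x.num = p at hr hcop hp0
  generalize ((x.den : ℕ) : ℤ) = q at hr hcop hq
  have hr' : p * q * (p ^ 2 + q ^ 2) = r ^ 2 := by linear_combination hr
  -- `p > 0` since `p q (p² + q²) = r² ≥ 0`, `q > 0`, `p ≠ 0`
  have hp : 0 < p := by
    rcases lt_or_gt_of_ne hp0 with hneg | hpos
    · exfalso
      have h1 : 0 < p ^ 2 + q ^ 2 := by positivity
      have h2 : p * q < 0 := mul_neg_of_neg_of_pos hneg hq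
      have : p * q * (p ^ 2 + q ^ 2) < 0 := mul_neg_of_neg_of_pos h2 h1
      nlinarith [sq_nonneg r]
    · exact hpos
  -- pairwise coprimality
  have c1 : IsCoprime (p ^ 2 + q ^ 2) p := Int.isCoprime_of_sq_sum hcop.symm
  have c2 : IsCoprime (p ^ 2 + q ^ 2) q := by
    have := Int.isCoprime_of_sq_sum (r := q) (s := p) hcop
    rwa [add_comm] at this
  -- the three squares
  obtain ⟨A, hA⟩ : ∃ A, p = A ^ 2 := by
    have hc : IsCoprime p (q * (p ^ 2 + q ^ 2)) := hcop.mul_right c1.symm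
    have h' : p * (q * (p ^ 2 + q ^ 2)) = r ^ 2 := by linear_combination hr'
    obtain ⟨A, hA | hA⟩ := Int.sq_of_isCoprime hc h'
    · exact ⟨A, hA⟩
    · nlinarith [sq_nonneg A]
  obtain ⟨B, hB⟩ : ∃ B, q = B ^ 2 := by
    have hc : IsCoprime q (p * (p ^ 2 + q ^ 2)) := hcop.symm.mul_right c2.symm
    have h' : q * (p * (p ^ 2 + q ^ 2)) = r ^ 2 := by linear_combination hr'
    obtain ⟨B, hB | hB⟩ := Int.sq_of_isCoprime hc h'
    · exact ⟨B, hB⟩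
    · nlinarith [sq_nonneg B]
  obtain ⟨C, hC⟩ : ∃ C, p ^ 2 + q ^ 2 = C ^ 2 := by
    have hc : IsCoprime (p ^ 2 + q ^ 2) (p * q) := c1.mul_right c2
    have h' : (p ^ 2 + q ^ 2) * (p * q) = r ^ 2 := by linear_combination hr'
    obtain ⟨C, hC | hC⟩ := Int.sq_of_isCoprime hc h'
    · exact ⟨C, hC⟩
    · nlinarith [sq_nonneg C, sq_nonneg p, sq_nonneg q]
  have hA0 : A ≠ 0 := by rintro rfl; simp at hA; omega
  have hB0 : B ≠ 0 := by rintro rfl; simp at hB; omega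
  exact not_fermat_42 hA0 hB0 (by rw [← hC, hA, hB]; ring)

/-! ### Part 9) of the printed proof (`m = 8`): the Diophantine tail -/

/-- In `ℤ`, coprime factors of an `8`-th power are `8`-th powers up to sign. [folklore] -/
private theorem exists_eq_pow_eight_of_mul_eq {s t w : ℤ} (hst : IsCoprime s t)
    (h : s * t = w ^ 8) : ∃ d : ℤ, s = d ^ 8 ∨ s = -d ^ 8 := by
  have hu : IsUnit (GCDMonoid.gcd s t) := by
    rw [← Int.coe_gcd, Int.isCoprime_iff_gcd_eq_one.mp hst, Int.ofNat_one]
    exact isUnit_one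
  obtain ⟨d, hd⟩ := exists_associated_pow_of_mul_eq_pow hu h
  rcases Int.associated_iff.mp hd with hd | hd
  · exact ⟨d, Or.inl hd.symm⟩
  · exact ⟨d, Or.inr (by linarith)⟩

/-- The point of part 9): if `a² - 4u⁴ = v⁴` then `(v²/(a-2u²), 2uv/(a-2u²))` lies on
`32A : y² = x³ - x` (over `ℚ`, `a - 2u² ≠ 0`). [cite: MestreOesterle1989, §4, proof of Thm. 1, part 9, p. 180] -/
private theorem point_on_32A {a u v : ℚ} (hD : a - 2 * u ^ 2 ≠ 0) (hrel : a ^ 2 - 4 * u ^ 4 = v ^ 4) :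
    (2 * u * v / (a - 2 * u ^ 2)) ^ 2 =
      (v ^ 2 / (a - 2 * u ^ 2)) ^ 3 - v ^ 2 / (a - 2 * u ^ 2) := by
  set D := a - 2 * u ^ 2 with hDdef
  have hD3 : D ^ 3 ≠ 0 := pow_ne_zero 3 hD
  have e1 : (2 * u * v / D) ^ 2 * D ^ 3 = 4 * u ^ 2 * v ^ 2 * D := by
    field_simp
    ring
  have e2 : ((v ^ 2 / D) ^ 3 - v ^ 2 / D) * D ^ 3 = v ^ 6 - v ^ 2 * D ^ 2 := by
    field_simp
  have e3 : 4 * u ^ 2 * v ^ 2 * D = v ^ 6 - v ^ 2 * D ^ 2 := by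
    have hkey : D ^ 2 + 4 * u ^ 2 * D = v ^ 4 := by rw [hDdef, ← hrel]; ring
    linear_combination (v ^ 2) * hkey
  exact mul_right_cancel₀ hD3 (by rw [e1, e2, e3])

/-- The point of part 9): if `a² - 4u⁴ = -v⁴` then `(-v²/(a-2u²), 2uv/(a-2u²))` lies on
`64A : y² = x³ + x` (over `ℚ`, `a - 2u² ≠ 0`). [cite: MestreOesterle1989, §4, proof of Thm. 1, part 9, p. 180] -/
private theorem point_on_64A {a u v : ℚ} (hD : a - 2 * u ^ 2 ≠ 0) (hrel : a ^ 2 - 4 * u ^ 4 = -v ^ 4) :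
    (2 * u * v / (a - 2 * u ^ 2)) ^ 2 =
      (-v ^ 2 / (a - 2 * u ^ 2)) ^ 3 + -v ^ 2 / (a - 2 * u ^ 2) := by
  set D := a - 2 * u ^ 2 with hDdef
  have hD3 : D ^ 3 ≠ 0 := pow_ne_zero 3 hD
  have e1 : (2 * u * v / D) ^ 2 * D ^ 3 = 4 * u ^ 2 * v ^ 2 * D := by
    field_simp
    ring
  have e2 : ((-v ^ 2 / D) ^ 3 + -v ^ 2 / D) * D ^ 3 = -v ^ 6 - v ^ 2 * D ^ 2 := by
    field_simp
    ring
  have e3 : 4 * u ^ 2 * v ^ 2 * D = -v ^ 6 - v ^ 2 * D ^ 2 := by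
    have hkey : D ^ 2 + 4 * u ^ 2 * D = -v ^ 4 := by rw [hDdef, ← hrel]; ring
    linear_combination (v ^ 2) * hkey
  exact mul_right_cancel₀ hD3 (by rw [e1, e2, e3])

/-- **Mestre–Oesterlé, proof of Thm. 1, part 9) (the case `m = 8`), its Diophantine content.**
"D'après 7) et 8), il existe des entiers `a` et `b` premiers entre eux tels que
`Δ = 2⁻⁸ b² (a² - 4b)` et `b > 0`" — and then `|Δ|` is NOT an `8`-th power: "Il existe donc
`ε ∈ {-1, 1}` et des entiers `u` et `v` tels que `b = u⁴` et `a² - 4b = ε v⁴`. Posons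
`x = ε v²/(a - 2u²)` et `y = 2uv/(a - 2u²)`, ce qui est licite puisque la non nullité de `Δ`
implique celle de `a - 2u²`. Les nombres rationnels `x` et `y` sont reliés par l'équation
`y² = x³ - εx`. Pour `ε = 1`, cette équation est l'équation de la courbe elliptique `32A` des
tables de [1]; pour `ε = -1`, c'est celle de la courbe elliptique `64A` de loc. cit. Dans les
deux cas, les seuls points rationnels de ces courbes sont des points d'ordre `2`. On a donc
`y = 0`, d'où `uv = 0`, ce qui est absurde puisque `Δ` est non nul." Formally: for coprime
integers `a`, `b` with `b > 0` and `a² ≠ 4b` (i.e. `Δ ≠ 0`), `b² |a² - 4b|` (`= 2⁸ |Δ|`) is not an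
`8`-th power. The two table facts are `eq_zero_of_sq_eq_cube_sub_self` and
`eq_zero_of_sq_eq_cube_add_self` above. (What is NOT formalised is the input "D'après 7) et 8)":
that a semistable `E/ℚ` with `|Δ_min|` an `8`-th power has such a model — Lemma 1 of the paper
and parts 3), 7), 8) of the proof, which rest on the finite flat group scheme `E[2]` over `ℤ`.)
[cite: MestreOesterle1989, §4, proof of Thm. 1, part 9, pp. 180–181] -/
theorem sq_mul_abs_ne_pow_eight {a b : ℤ} (hab : IsCoprime a b) (hb : 0 < b)
    (hΔ : a ^ 2 ≠ 4 * b) (w : ℤ) : b ^ 2 * |a ^ 2 - 4 * b| ≠ w ^ 8 := by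
  intro h
  -- `b²` and `a² - 4b` are coprime
  have c00 : IsCoprime b (a ^ 2) := hab.symm.pow_right
  have c0 : IsCoprime b (a ^ 2 - 4 * b) :=
    isCoprime_of_eq_right (c00.add_mul_left_right (-4)) (by ring)
  have c1 : IsCoprime (b ^ 2) |a ^ 2 - 4 * b| := by
    rcases abs_choice (a ^ 2 - 4 * b) with h' | h' <;> rw [h']
    · exact c0.pow_left
    · exact c0.pow_left.neg_right
  -- hence both are `8`-th powers (up to sign): `b = u⁴`, `|a² - 4b| = v⁴` with `v = t²`
  obtain ⟨u, hd⟩ := exists_eq_pow_eight_of_mul_eq c1 h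
  have hu8 : (0 : ℤ) ≤ u ^ 8 := by positivity
  have hb2 : b ^ 2 = (u ^ 4) ^ 2 := by
    rcases hd with hd | hd
    · rw [hd]; ring
    · nlinarith [sq_nonneg b]
  have hbu : b = u ^ 4 := by
    rcases sq_eq_sq_iff_eq_or_eq_neg.mp hb2 with h' | h'
    · exact h'
    · have : (0 : ℤ) ≤ u ^ 4 := by positivity
      linarith
  obtain ⟨t, ht⟩ := exists_eq_pow_eight_of_mul_eq c1.symm (by rw [mul_comm]; exact h)
  have habs : |a ^ 2 - 4 * b| = t ^ 8 := by
    rcases ht with ht | ht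
    · exact ht
    · exfalso
      have h1 : 0 ≤ |a ^ 2 - 4 * b| := abs_nonneg _
      have h2 : (0 : ℤ) ≤ t ^ 8 := by positivity
      have h3 : |a ^ 2 - 4 * b| = 0 := by linarith
      exact hΔ (by linarith [abs_eq_zero.mp h3])
  set v := t ^ 2 with hv
  have hv4 : |a ^ 2 - 4 * b| = v ^ 4 := by rw [habs, hv]; ring
  -- `u ≠ 0`, `v ≠ 0`, `a - 2u² ≠ 0`
  have hu0 : u ≠ 0 := by
    rintro rfl
    simp at hbu
    omega
  have hv0 : v ≠ 0 := by
    intro h0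
    have h3 : |a ^ 2 - 4 * b| = 0 := by rw [hv4, h0]; ring
    exact hΔ (by linarith [abs_eq_zero.mp h3])
  have hD : a - 2 * u ^ 2 ≠ 0 := by
    intro h0
    have : a = 2 * u ^ 2 := by linarith
    apply hΔ
    rw [this, hbu]; ring
  have hDQ : (a : ℚ) - 2 * (u : ℚ) ^ 2 ≠ 0 := by exact_mod_cast hD
  have huv : (2 * (u : ℚ) * v) / ((a : ℚ) - 2 * (u : ℚ) ^ 2) ≠ 0 := by
    refine div_ne_zero ?_ hDQ
    have : (2 * u * v : ℤ) ≠ 0 := by positivity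
    exact_mod_cast this
  -- the two signs
  rcases (abs_eq (by positivity : (0 : ℤ) ≤ v ^ 4)).mp hv4 with hε | hε
  · -- `ε = 1`: the point `(v²/(a-2u²), 2uv/(a-2u²))` on `32A : y² = x³ - x`
    have hrel : (a : ℚ) ^ 2 - 4 * (u : ℚ) ^ 4 = (v : ℚ) ^ 4 := by
      have : a ^ 2 - 4 * u ^ 4 = v ^ 4 := by rw [hbu] at hε; linarith
      exact_mod_cast this
    exact huv (eq_zero_of_sq_eq_cube_sub_self (point_on_32A hDQ hrel))
  · -- `ε = -1`: the point `(-v²/(a-2u²), 2uv/(a-2u²))` on `64A : y² = x³ + x`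
    have hrel : (a : ℚ) ^ 2 - 4 * (u : ℚ) ^ 4 = -(v : ℚ) ^ 4 := by
      have : a ^ 2 - 4 * u ^ 4 = -v ^ 4 := by rw [hbu] at hε; linarith
      exact_mod_cast this
    exact huv (eq_zero_of_sq_eq_cube_add_self (point_on_64A hDQ hrel))


/-! ### Lemme 1: the discriminant of the `2`-torsion model -/

/-- **Mestre–Oesterlé, Lemme 1, the discriminant of the `2`-torsion model.** For the Weierstrass
equation `y² = x(x² + ax + b) = x³ + ax² + bx` (any commutative ring), `Δ = 16 b² (a² - 4b)`
("Son discriminant est `16b²(a² - 4b)`, et est égal à `2¹²Δ`", p. 176; so for the model of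
Lemme 1, minimal away from `2`, `Δ_min = 2⁻⁸ b²(a² - 4b)`, the quantity of part 9)). Only this
identity is formalised, not the existence and uniqueness of the model nor its minimality (Tate's
algorithm at `2`). [cite: MestreOesterle1989, §3, Lemme 1 and its proof, pp. 175–176] -/
theorem Δ_twoTorsionModel {R : Type*} [CommRing R] (a b : R) :
    (⟨0, a, 0, b, 0⟩ : WeierstrassCurve R).Δ = 16 * b ^ 2 * (a ^ 2 - 4 * b) := by
  simp only [WeierstrassCurve.Δ, WeierstrassCurve.b₂, WeierstrassCurve.b₄, WeierstrassCurve.b₆,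
    WeierstrassCurve.b₈]
  ring

/-! ### The Mazur step of the Corollary of Prop. 1 -/

section Mazur

open WeierstrassCurve

variable {W : WeierstrassCurve ℚ}

/-- **Orders of finite subgroups of `E(ℚ)` under Mazur's theorem.** If `E(ℚ)_tors` is one of
Mazur's fifteen groups (`mazur_torsion W`: `ℤ/n`, `n ≤ 10` or `n = 12`, or `ℤ/2 × ℤ/2m`,
`m ≤ 4`), then every finite subgroup `H ⊆ E(ℚ)` (necessarily `H ⊆ E(ℚ)_tors`) has order
`≤ 10`, `12` or `16` (Lagrange). [cite: Mazur1977, Thm 8] -/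
theorem card_le_of_mazur_torsion (h : mazur_torsion W) [W.IsElliptic]
    (H : AddSubgroup W.toAffine.Point) [Finite H] :
    Nat.card H ≤ 10 ∨ Nat.card H = 12 ∨ Nat.card H = 16 := by
  -- `H` is contained in the torsion subgroup
  have hle : H ≤ AddCommGroup.torsion W.toAffine.Point := by
    intro P hP
    rw [AddCommGroup.mem_torsion]
    exact H.subtype.isOfFinAddOrder (isOfFinAddOrder_of_finite (⟨P, hP⟩ : H))
  have hdvd : Nat.card H ∣ Nat.card (AddCommGroup.torsion W.toAffine.Point) :=
    AddSubgroup.card_dvd_of_le hle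
  set d := Nat.card H with hd
  rcases h with ⟨n, hn1, hnS, ⟨e⟩⟩ | ⟨m, hm1, hm4, ⟨e⟩⟩
  · rw [Nat.card_congr e.toEquiv, Nat.card_zmod] at hdvd
    have hdn : d ≤ n := Nat.le_of_dvd (by omega) hdvd
    rcases hnS with hn | rfl
    · left; omega
    · by_cases h12 : d = 12
      · right; left; exact h12
      · by_cases h11 : d = 11
        · exfalso; rw [h11] at hdvd; norm_num at hdvd
        · left; omega
  · rw [Nat.card_congr e.toEquiv, Nat.card_prod, Nat.card_zmod, Nat.card_zmod] at hdvd
    have hdn : d ≤ 2 * (2 * m) := Nat.le_of_dvd (by omega) hdvd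
    interval_cases m
    · left; omega
    · left; omega
    · by_cases h12 : d = 12
      · right; left; exact h12
      · by_cases h11 : d = 11
        · exfalso; rw [h11] at hdvd; norm_num at hdvd
        · left; omega
    · by_cases h16 : d = 16
      · right; right; exact h16
      · have : d ≠ 11 ∧ d ≠ 12 ∧ d ≠ 13 ∧ d ≠ 14 ∧ d ≠ 15 := by
          refine ⟨?_, ?_, ?_, ?_, ?_⟩ <;> (intro hd'; rw [hd'] at hdvd; norm_num at hdvd)
        left; omega

/-- **Mestre–Oesterlé, Corollary of Prop. 1, the Mazur step.** "il existe alors une courbe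
elliptique `E'` définie sur `ℚ` telle que `E'(ℚ)` contienne un sous-groupe fini dont l'ordre est
égal à `ℓ` avec `ℓ ≥ 11`, à `2ℓ` avec `ℓ ≥ 7` ou à `4ℓ` avec `ℓ ≥ 5`. Cela contredit un théorème
de Mazur ([10], th. 8) qui affirme que pour toute courbe elliptique `E'` définie sur `ℚ` (même
non semi-stable), le sous-groupe de torsion de `E'(ℚ)` est isomorphe à l'un des groupes
suivants: `ℤ/nℤ` avec `n ≤ 10` ou `n = 12`, `ℤ/2ℤ × ℤ/2nℤ` avec `n ≤ 4`." Formally, from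
`mazur_torsion W` (the tree's named fact for Mazur's Thm. 8): no finite subgroup of `E'(ℚ)` has
order `ℓ` (`ℓ ≥ 11` prime), `2ℓ` (`ℓ ≥ 7` prime) or `4ℓ` (`ℓ ≥ 5` prime). (The other half of the
Corollary — Prop. 1 itself: for semistable `E`, `ρ_ℓ` reducible forces such a subgroup on `E` or
on an isogenous `E/A`, Serre 1972 p. 307 — is not in the tree.)
[cite: MestreOesterle1989, §1, Corollaire de la Prop. 1, p. 174] -/
theorem corollary_prop_1_mazur_step (h : mazur_torsion W) [W.IsElliptic]
    (H : AddSubgroup W.toAffine.Point) [Finite H] {ℓ : ℕ} (hℓ : ℓ.Prime) :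
    ¬ (11 ≤ ℓ ∧ Nat.card H = ℓ) ∧ ¬ (7 ≤ ℓ ∧ Nat.card H = 2 * ℓ) ∧
      ¬ (5 ≤ ℓ ∧ Nat.card H = 4 * ℓ) := by
  have hc := card_le_of_mazur_torsion h H
  refine ⟨?_, ?_, ?_⟩
  · rintro ⟨h11, hcard⟩
    rw [hcard] at hc
    rcases hc with hc | hc | hc
    · omega
    · rw [hc] at hℓ; norm_num at hℓ
    · rw [hc] at hℓ; norm_num at hℓ
  · rintro ⟨h7, hcard⟩
    rw [hcard] at hc
    rcases hc with hc | hc | hc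
    · omega
    · omega
    · have : ℓ = 8 := by omega
      rw [this] at hℓ; norm_num at hℓ
  · rintro ⟨h5, hcard⟩
    omega

/-- In particular (the case used for `ℓ ≥ 11`): under Mazur's theorem no rational point of an
elliptic curve over `ℚ` has prime order `ℓ ≥ 11`. [cite: MestreOesterle1989, §1, Corollaire de la Prop. 1, case a, p. 174] -/
theorem addOrderOf_lt_eleven_of_mazur_torsion (h : mazur_torsion W) [W.IsElliptic]
    (P : W.toAffine.Point) (hP : (addOrderOf P).Prime) : addOrderOf P < 11 := by
  by_contra hge
  push Not at hge
  haveI : Finite (AddSubgroup.zmultiples P) := by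
    have hfin : IsOfFinAddOrder P := addOrderOf_pos_iff.mp hP.pos
    exact hfin.finite_zmultiples
  have hcard : Nat.card (AddSubgroup.zmultiples P) = addOrderOf P := Nat.card_zmultiples P
  exact (corollary_prop_1_mazur_step h (AddSubgroup.zmultiples P) hP).1 ⟨hge, hcard⟩

end Mazur

/-! ### The last step of the Corollary of Prop. 2: `S₂(Γ₀(M)) = 0` for `M ∣ 6, 10, 7, 13` -/

section Prop2

open CongruenceSubgroup Literature.NumberTheory.EllipticCurves.ModularForms

/-- **Mestre–Oesterlé, Corollary of Prop. 2, last step.** "… la conclusion de la prop. 2 serait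
satisfaite, avec `M` un diviseur de `6`, `10`, `7` ou `13`. Or il n'existe pas de forme modulaire
parabolique non nulle de poids `2` pour `Γ₀(M)`, avec `M` un tel entier." Indeed such an `M` is
`≤ 10` or `= 13`, and `S₂(Γ₀(M)) = 0` for these levels (genus `0`): the tree's PROVED
`cuspForm_two_gamma0_eq_zero_of_le_ten` (`M ≤ 10`) and `finrank_cuspForm_two_eq_genusX0_thirteen`
with `g(X₀(13)) = 0` (`gamma0_data_13`). (Prop. 2 itself — Ribet's level-lowering for the
irreducible `ρ_ℓ` of a semistable Weil curve — is not in the tree.)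
[cite: MestreOesterle1989, §2, Corollaire de la Prop. 2, p. 175] -/
theorem cuspForm_two_eq_zero_of_dvd {M : ℕ} [NeZero M]
    (hM : M ∣ 6 ∨ M ∣ 10 ∨ M ∣ 7 ∨ M ∣ 13) (f : CuspForm (Gamma0 M) 2) : f = 0 := by
  by_cases h13 : M = 13
  · subst h13
    have hfd : FiniteDimensional ℂ (CuspForm (Gamma0 13) 2) :=
      finiteDimensional_cuspForm_gamma0 13 2
    have h0 : Module.finrank ℂ (CuspForm (Gamma0 13) 2) = 0 := by
      have h := finrank_cuspForm_two_eq_genusX0_thirteen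
      unfold finrank_cuspForm_two_eq_genusX0 at h
      obtain ⟨hμ, hν, h₂, h₃⟩ := gamma0_data_13
      rw [h, genusX0, hμ, hν, h₂, h₃]
    exact finrank_zero_iff_forall_zero.mp h0 f
  · have hle : M ≤ 10 := by
      rcases hM with h | h | h | h
      · exact (Nat.le_of_dvd (by norm_num) h).trans (by norm_num)
      · exact Nat.le_of_dvd (by norm_num) h
      · exact (Nat.le_of_dvd (by norm_num) h).trans (by norm_num)
      · have : M = 1 ∨ M = 13 := (Nat.dvd_prime (by norm_num)).mp h
        omega
    exact cuspForm_two_gamma0_eq_zero_of_le_ten hle f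

end Prop2

end MestreOesterle

end Literature.NumberTheory.EllipticCurves

end
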